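import Mathlib
import HarnessLib

/-!
# The SIGN of the delete-one-block jackknife bias correction: for a CONVEX statistic of the pooled mean (`free_energy`'s `−log`) `dF_biascorr ≤ dF ≤ mean of the per-block estimates`, for every sample

HONEST FRAMING: exact (Metropolis-corrected) sampling algorithms for lattice gauge theory;
figures of merit are autocorrelation/cost numbers at stated couplings and volumes; no
continuum-physics claim.

Venture `LatticeQCDFlow` (cell pub-lqcd), topic `Exactness`; FANOUT row 13 (`eng-snf`, GEN-25).
NEW WORK of the cell (elementary: finite Jensen `ConvexOn.map_sum_le` and the leave-one-out
averaging identity in a real vector space), Mathlib only; not a published result; no definition;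
nothing cited as a fact (Quenouille–Tukey jackknife NAMED ONLY).

WHY (row 13). `latflow-snf`'s `estimators.jackknife` prints, next to the full-sample statistic `full
= φ(ᾱ)` (`ᾱ` the POOLED mean of the block means `α_r`, `R = n_blocks ≥ 2`), the delete-one-block
replicates `φ(ᾱ_{(−r)})`, their mean `m = (1/R) Σ_r φ(ᾱ_{(−r)})` and the bias-corrected value
`bias_corr = R·full − (R−1)·m` (`free_energy`: `dF`, `dF_biascorr` with `φ = −log`; `Zratio` with `φ
= id`). GEN-11 (`NCMCGeneralSpaceEstimatorBias.jackknife_integral_le`) typed the EXPECTATION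
statement for i.i.d. records; GEN-25 (`…ReplicaJackknifeDeltaMethod`) that the correction is
`o_P(n^{−1/2})` for the coverage. This file records the DETERMINISTIC fact behind the printed pair,
valid for every sample, every block structure and every dependence: the leave-one-out pooled means
average to the pooled mean (`(1/R) Σ_r ᾱ_{(−r)} = ᾱ`, in any real vector space), hence for a CONVEX
`φ` Jensen gives `φ(ᾱ) ≤ m`, i.e. **`bias_corr ≤ full`** (concave: `≥`; affine, e.g. `Zratio`: `=`).
For `free_energy` (`φ = −log`, positive block mean weights): `dF_biascorr ≤ dF`, and (Jensen once
more, on the block means themselves) `dF ≤ (1/R) Σ_r (−log Ȳ_r)` — the pooled estimate never exceeds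
the mean of the per-block estimates (GEN-24 J's centre): the printed correction always acts AGAINST
the known positive bias of the Jarzynski estimator (GEN-11), never with it.

* `invCard_smul_sum_looMean` (§1) — `R⁻¹ • Σ_r ((R−1)⁻¹ • Σ_{s≠r} α_s) = R⁻¹ • Σ_r α_r` (module
  over `ℝ`, `R ≥ 2`).
* **`convexOn_map_pooledMean_le_mean_loo`**, **`convexOn_jackknife_biasCorrected_le`** (§2) and the
  concave mirrors.
* **`neg_log_pooledMean_biasCorrected_le`**, **`neg_log_pooledMean_le_mean_neg_log`** (§3) — the
  `free_energy` instances (`dF_biascorr ≤ dF ≤ (1/R) Σ_r dF̂_r`).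

NOT CLAIMED: the size of the correction; strictness; anything about its expectation beyond GEN-11;
anything numerical.
-/

namespace Summit.Ventures.LatticeQCDFlow.Exactness.GeneralNCMC

open Finset

/-! ## §1 The leave-one-out pooled means average to the pooled mean -/

section LeaveOneOut

variable {ι : Type*} [Fintype ι] [DecidableEq ι] {E : Type*} [AddCommGroup E] [Module ℝ E]

/-- `Σ_r Σ_{s ≠ r} α_s = (R − 1) • Σ_s α_s`. -/
theorem sum_sum_erase_eq_smul (α : ι → E) :
    ∑ r, ∑ s ∈ univ.erase r, α s = ((Fintype.card ι : ℝ) - 1) • ∑ s, α s := by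
  simp_rw [sum_erase_eq_sub (mem_univ _)]
  rw [sum_sub_distrib, sum_const, card_univ, ← Nat.cast_smul_eq_nsmul ℝ, sub_smul, one_smul]

/-- **The leave-one-out pooled means average to the pooled mean** (any real vector space, `R ≥ 2`):
`R⁻¹ • Σ_r ((R−1)⁻¹ • Σ_{s ≠ r} α_s) = R⁻¹ • Σ_r α_r`. -/
theorem invCard_smul_sum_looMean (hR : 2 ≤ Fintype.card ι) (α : ι → E) :
    (Fintype.card ι : ℝ)⁻¹ • ∑ r, ((Fintype.card ι : ℝ) - 1)⁻¹ • ∑ s ∈ univ.erase r, α s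
      = (Fintype.card ι : ℝ)⁻¹ • ∑ r, α r := by
  have hR1 : (Fintype.card ι : ℝ) - 1 ≠ 0 := by
    have : (2 : ℝ) ≤ Fintype.card ι := by exact_mod_cast hR
    linarith
  rw [← smul_sum, sum_sum_erase_eq_smul, smul_smul, smul_smul, mul_assoc, inv_mul_cancel₀ hR1,
    mul_one]

/-- The same as a weighted average with weights `1/R`: `Σ_r R⁻¹ • ᾱ_{(−r)} = ᾱ`. -/
theorem sum_invCard_smul_looMean (hR : 2 ≤ Fintype.card ι) (α : ι → E) :
    ∑ r, (Fintype.card ι : ℝ)⁻¹ • (((Fintype.card ι : ℝ) - 1)⁻¹ • ∑ s ∈ univ.erase r, α s)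
      = (Fintype.card ι : ℝ)⁻¹ • ∑ r, α r := by
  rw [← smul_sum, invCard_smul_sum_looMean hR α]

end LeaveOneOut

/-! ## §2 Jensen: the sign of the jackknife bias correction for convex / concave statistics -/

section Jensen

variable {ι : Type*} [Fintype ι] [DecidableEq ι] {E : Type*} [AddCommGroup E] [Module ℝ E]

/-- **Convex statistic: the full value is at most the mean of the leave-one-out replicates**,
`φ(ᾱ) ≤ (1/R) Σ_r φ(ᾱ_{(−r)})`, whenever `φ` is convex on a convex set containing every
leave-one-out pooled mean (`R ≥ 2`). -/
theorem convexOn_map_pooledMean_le_mean_loo {t : Set E} {φ : E → ℝ} (hφ : ConvexOn ℝ t φ)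
    (hR : 2 ≤ Fintype.card ι) (α : ι → E)
    (hmem : ∀ r, ((Fintype.card ι : ℝ) - 1)⁻¹ • ∑ s ∈ univ.erase r, α s ∈ t) :
    φ ((Fintype.card ι : ℝ)⁻¹ • ∑ r, α r)
      ≤ (∑ r, φ (((Fintype.card ι : ℝ) - 1)⁻¹ • ∑ s ∈ univ.erase r, α s)) / Fintype.card ι := by
  have hR0 : (Fintype.card ι : ℝ) ≠ 0 := by
    have : (2 : ℝ) ≤ Fintype.card ι := by exact_mod_cast hR
    positivity
  have h := hφ.map_sum_le (t := (univ : Finset ι)) (w := fun _ => (Fintype.card ι : ℝ)⁻¹)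
    (p := fun r => ((Fintype.card ι : ℝ) - 1)⁻¹ • ∑ s ∈ univ.erase r, α s)
    (fun _ _ => by positivity)
    (by rw [sum_const, card_univ, nsmul_eq_mul, mul_inv_cancel₀ hR0]) (fun r _ => hmem r)
  rw [sum_invCard_smul_looMean hR α] at h
  refine h.trans (le_of_eq ?_)
  simp only [smul_eq_mul, ← mul_sum]
  rw [inv_mul_eq_div]

/-- **THE JACKKNIFE BIAS CORRECTION LOWERS A CONVEX STATISTIC**: `R·φ(ᾱ) − (R−1)·m ≤ φ(ᾱ)`,
`m = (1/R) Σ_r φ(ᾱ_{(−r)})` — the engine's `bias_corr ≤ full` for every sample. -/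
theorem convexOn_jackknife_biasCorrected_le {t : Set E} {φ : E → ℝ} (hφ : ConvexOn ℝ t φ)
    (hR : 2 ≤ Fintype.card ι) (α : ι → E)
    (hmem : ∀ r, ((Fintype.card ι : ℝ) - 1)⁻¹ • ∑ s ∈ univ.erase r, α s ∈ t) :
    (Fintype.card ι : ℝ) * φ ((Fintype.card ι : ℝ)⁻¹ • ∑ r, α r)
        - ((Fintype.card ι : ℝ) - 1)
          * ((∑ r, φ (((Fintype.card ι : ℝ) - 1)⁻¹ • ∑ s ∈ univ.erase r, α s)) / Fintype.card ι)
      ≤ φ ((Fintype.card ι : ℝ)⁻¹ • ∑ r, α r) := by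
  have hR1 : (0 : ℝ) ≤ (Fintype.card ι : ℝ) - 1 := by
    have : (2 : ℝ) ≤ Fintype.card ι := by exact_mod_cast hR
    linarith
  have h := convexOn_map_pooledMean_le_mean_loo hφ hR α hmem
  nlinarith [mul_le_mul_of_nonneg_left h hR1]

/-- Concave mirror: `(1/R) Σ_r φ(ᾱ_{(−r)}) ≤ φ(ᾱ)`. -/
theorem concaveOn_mean_loo_le_map_pooledMean {t : Set E} {φ : E → ℝ} (hφ : ConcaveOn ℝ t φ)
    (hR : 2 ≤ Fintype.card ι) (α : ι → E)
    (hmem : ∀ r, ((Fintype.card ι : ℝ) - 1)⁻¹ • ∑ s ∈ univ.erase r, α s ∈ t) :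
    (∑ r, φ (((Fintype.card ι : ℝ) - 1)⁻¹ • ∑ s ∈ univ.erase r, α s)) / Fintype.card ι
      ≤ φ ((Fintype.card ι : ℝ)⁻¹ • ∑ r, α r) := by
  have h := convexOn_map_pooledMean_le_mean_loo hφ.neg hR α hmem
  simp only [Pi.neg_apply, sum_neg_distrib, neg_div] at h
  exact neg_le_neg_iff.1 h

/-- **Concave statistic: the bias correction RAISES it**, `φ(ᾱ) ≤ R·φ(ᾱ) − (R−1)·m`. -/
theorem concaveOn_le_jackknife_biasCorrected {t : Set E} {φ : E → ℝ} (hφ : ConcaveOn ℝ t φ)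
    (hR : 2 ≤ Fintype.card ι) (α : ι → E)
    (hmem : ∀ r, ((Fintype.card ι : ℝ) - 1)⁻¹ • ∑ s ∈ univ.erase r, α s ∈ t) :
    φ ((Fintype.card ι : ℝ)⁻¹ • ∑ r, α r)
      ≤ (Fintype.card ι : ℝ) * φ ((Fintype.card ι : ℝ)⁻¹ • ∑ r, α r)
        - ((Fintype.card ι : ℝ) - 1)
          * ((∑ r, φ (((Fintype.card ι : ℝ) - 1)⁻¹ • ∑ s ∈ univ.erase r, α s))
            / Fintype.card ι) := by
  have hR1 : (0 : ℝ) ≤ (Fintype.card ι : ℝ) - 1 := by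
    have : (2 : ℝ) ≤ Fintype.card ι := by exact_mod_cast hR
    linarith
  have h := concaveOn_mean_loo_le_map_pooledMean hφ hR α hmem
  nlinarith [mul_le_mul_of_nonneg_left h hR1]

end Jensen

/-! ## §3 `free_energy`: `dF_biascorr ≤ dF ≤ (1/R) Σ_r dF̂_r` for every sample -/

section FreeEnergy

variable {ι : Type*} [Fintype ι] [DecidableEq ι]

/-- `−log` is convex on `(0, ∞)`. -/
theorem convexOn_neg_log : ConvexOn ℝ (Set.Ioi (0 : ℝ)) (fun x => -Real.log x) :=
  strictConcaveOn_log_Ioi.concaveOn.neg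

/-- **`dF_biascorr ≤ dF` FOR EVERY SAMPLE**: with positive block mean weights `y_r` (`R ≥ 2`),
`R·dF − (R−1)·m ≤ dF`, `dF = −log((Σ_r y_r)/R)`, `m = (1/R) Σ_r (−log((Σ_{s≠r} y_s)/(R−1)))`. -/
theorem neg_log_pooledMean_biasCorrected_le (hR : 2 ≤ Fintype.card ι) {y : ι → ℝ}
    (hy : ∀ r, 0 < y r) :
    (Fintype.card ι : ℝ) * (-Real.log ((∑ r, y r) / Fintype.card ι))
        - ((Fintype.card ι : ℝ) - 1)
          * ((∑ r, -Real.log ((∑ s ∈ univ.erase r, y s) / ((Fintype.card ι : ℝ) - 1)))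
            / Fintype.card ι)
      ≤ -Real.log ((∑ r, y r) / Fintype.card ι) := by
  have hR1 : (0 : ℝ) < (Fintype.card ι : ℝ) - 1 := by
    have : (2 : ℝ) ≤ Fintype.card ι := by exact_mod_cast hR
    linarith
  have hne : ∀ r : ι, (univ.erase r).Nonempty := fun r => by
    have : 1 < Fintype.card ι := hR
    obtain ⟨s, hs⟩ := Fintype.exists_ne_of_one_lt_card this r
    exact ⟨s, mem_erase.2 ⟨hs, mem_univ s⟩⟩
  have hmem : ∀ r, ((Fintype.card ι : ℝ) - 1)⁻¹ • ∑ s ∈ univ.erase r, y s ∈ Set.Ioi (0 : ℝ) :=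
    fun r => by
      rw [Set.mem_Ioi, smul_eq_mul]
      exact mul_pos (inv_pos.2 hR1) (sum_pos (fun s _ => hy s) (hne r))
  have h := convexOn_jackknife_biasCorrected_le convexOn_neg_log hR y hmem
  simp only [smul_eq_mul, inv_mul_eq_div] at h
  exact h

omit [DecidableEq ι] in
/-- **`dF ≤ (1/R) Σ_r dF̂_r` FOR EVERY SAMPLE**: the pooled estimate `−log((Σ_r y_r)/R)` never
exceeds the mean of the per-block estimates `−log y_r` (Jensen for the convex `−log` on the block
means). -/
theorem neg_log_pooledMean_le_mean_neg_log [Nonempty ι] {y : ι → ℝ} (hy : ∀ r, 0 < y r) :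
    -Real.log ((∑ r, y r) / Fintype.card ι) ≤ (∑ r, -Real.log (y r)) / Fintype.card ι := by
  have hR0 : (Fintype.card ι : ℝ) ≠ 0 := Nat.cast_ne_zero.2 Fintype.card_ne_zero
  have h := convexOn_neg_log.map_sum_le (t := (univ : Finset ι))
    (w := fun _ => (Fintype.card ι : ℝ)⁻¹) (p := y) (fun _ _ => by positivity)
    (by rw [sum_const, card_univ, nsmul_eq_mul, mul_inv_cancel₀ hR0])
    (fun r _ => Set.mem_Ioi.2 (hy r))
  simp only [smul_eq_mul, ← mul_sum] at h
  rw [inv_mul_eq_div, inv_mul_eq_div] at h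
  exact h

/-- **The chain `dF_biascorr ≤ dF ≤ (1/R) Σ_r dF̂_r`** (positive block mean weights, `R ≥ 2`). -/
theorem neg_log_pooledMean_biasCorrected_le_mean_neg_log (hR : 2 ≤ Fintype.card ι) {y : ι → ℝ}
    (hy : ∀ r, 0 < y r) :
    (Fintype.card ι : ℝ) * (-Real.log ((∑ r, y r) / Fintype.card ι))
        - ((Fintype.card ι : ℝ) - 1)
          * ((∑ r, -Real.log ((∑ s ∈ univ.erase r, y s) / ((Fintype.card ι : ℝ) - 1)))
            / Fintype.card ι)
      ≤ (∑ r, -Real.log (y r)) / Fintype.card ι := by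
  haveI : Nonempty ι := Fintype.card_pos_iff.1 (by omega)
  exact (neg_log_pooledMean_biasCorrected_le hR hy).trans (neg_log_pooledMean_le_mean_neg_log hy)

end FreeEnergy

end Summit.Ventures.LatticeQCDFlow.Exactness.GeneralNCMC
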